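import Mathlib.MeasureTheory.Integral.MeanInequalities
import Literature.Analysis.FunctionSpaces.TorusCalculusProofs
import HarnessLib

/-!
# The `L⁴` interpolation inequality for first derivatives on the flat torus

Analysis/FunctionSpaces support file (everything proved; no named facts). The elementary
Gagliardo–Nirenberg inequality

  `∫_{𝕋^d} (∂ⱼ h)⁴ ≤ 9 ‖h‖_∞² ∫_{𝕋^d} (∂ⱼ∂ⱼ h)²`      (`integral_partialDeriv_pow_four_le`)

for a smooth real function `h` on `𝕋^d = (ℝ/ℤ)^d` and a coordinate direction `j`: one
integration by parts in the direction `j` (`∫ ∂ⱼ(h (∂ⱼh)³) = 0`, i.e.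
`∫ (∂ⱼh)⁴ = -3 ∫ h (∂ⱼh)² ∂ⱼ²h`) and the Cauchy–Schwarz inequality. Applied to `h = ∂ᵢφ` it
bounds the `L⁴` norm of SECOND derivatives of `φ` by the sup norm of the first and the `L²`
norm of the third derivatives (`integral_partialDeriv_partialDeriv_pow_four_le`), which is the
single interpolation inequality needed to close the `H³` energy estimate of a quasilinear
symmetric hyperbolic system from a `C¹` bound (Majda 1984, Ch. 2, proof of Thm 2.2: the
continuation principle; Moser-type calculus inequalities, Prop. 2.1 (2.2)); together with the
Cauchy–Schwarz bound `∫ (FG)² ≤ (∫ F⁴)^{1/2} (∫ G⁴)^{1/2}` (`integral_mul_sq_le`) it controls the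
products of two second derivatives appearing in third-order commutators.

## References

* A. Majda, *Compressible Fluid Flow and Systems of Conservation Laws in Several Space
  Variables*, Springer 1984, Ch. 2 §2.1, Prop. 2.1 and the proof of Thm 2.2. [`Majda1984`]
* L. Nirenberg, *On elliptic partial differential equations*, Ann. Sc. Norm. Super. Pisa 13
  (1959), Lecture II (the interpolation inequalities). [folklore]
-/

noncomputable section

open MeasureTheory Set

namespace Literature.Analysis.FunctionSpaces

namespace Torus

variable {d : Type*} [Fintype d] [DecidableEq d]

/-- Cube of a smooth function: `∂ⱼ(g³) = 3 g² ∂ⱼg` on the torus. [folklore] -/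
theorem partialDeriv_pow_three {g : UnitAddTorus d → ℝ} (hg : IsSmooth g) (j : d)
    (x : UnitAddTorus d) :
    partialDeriv j (fun y => g y ^ 3) x = 3 * g x ^ 2 * partialDeriv j g x := by
  have h1 : IsContDiff 1 g := hg.isContDiff (by simp)
  have hgg : IsSmooth (fun y => g y * g y) := (ContDiff.mul hg hg : IsSmooth fun y => g y * g y)
  have e : (fun y => g y ^ 3) = fun y => g y * (g y * g y) := by
    funext y; ring
  rw [e, partialDeriv_mul h1 (hgg.isContDiff (by simp)), partialDeriv_mul h1 h1]
  ring

/-- **Integration by parts behind the interpolation inequality**: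
`∫ (∂ⱼh)⁴ = -3 ∫ h (∂ⱼh)² ∂ⱼ²h` for smooth `h` on `𝕋^d` (`∫ ∂ⱼ(h (∂ⱼh)³) = 0`). [folklore] -/
theorem integral_partialDeriv_pow_four_eq {h : UnitAddTorus d → ℝ} (hh : IsSmooth h) (j : d) :
    ∫ x, partialDeriv j h x ^ 4 =
      -3 * ∫ x, h x * partialDeriv j h x ^ 2 * partialDeriv j (partialDeriv j h) x := by
  classical
  set g := partialDeriv j h with hgdef
  have hg : IsSmooth g := hh.partialDeriv j
  have hg3 : IsSmooth (fun y => g y ^ 3) := by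
    have : IsSmooth (fun y => g y * (g y * g y)) :=
      (ContDiff.mul hg (ContDiff.mul hg hg) : IsSmooth fun y => g y * (g y * g y))
    simpa [pow_succ, mul_assoc] using this
  have hF : IsSmooth (fun y => h y * g y ^ 3) := (ContDiff.mul hh hg3 : IsSmooth fun y => h y * g y ^ 3)
  -- `∂ⱼ(h g³) = g⁴ + 3 h g² ∂ⱼg`
  have hpt : ∀ x, partialDeriv j (fun y => h y * g y ^ 3) x =
      g x ^ 4 + 3 * (h x * g x ^ 2 * partialDeriv j g x) := fun x => by
    rw [partialDeriv_mul (hh.isContDiff (by simp)) (hg3.isContDiff (by simp)), partialDeriv_pow_three hg j x]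
    simp only [hgdef]
    ring
  have h0 : ∫ x, partialDeriv j (fun y => h y * g y ^ 3) x = 0 :=
    integral_partialDeriv_eq_zero_holds hF j
  have hi1 : Integrable (fun x => g x ^ 4) volume := by
    have : IsSmooth (fun y => g y ^ 4) := by
      have : IsSmooth (fun y => (g y * g y) * (g y * g y)) :=
        (ContDiff.mul (ContDiff.mul hg hg) (ContDiff.mul hg hg) : IsSmooth fun y => (g y * g y) * (g y * g y))
      simpa [pow_succ, mul_assoc] using this
    exact this.integrable
  have hi2 : Integrable (fun x => 3 * (h x * g x ^ 2 * partialDeriv j g x)) volume := by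
    have : IsSmooth (fun y => h y * (g y * g y) * partialDeriv j g y) :=
      (ContDiff.mul (ContDiff.mul hh (ContDiff.mul hg hg)) (hg.partialDeriv j) :
        IsSmooth fun y => h y * (g y * g y) * partialDeriv j g y)
    have hi : Integrable (fun x => h x * g x ^ 2 * partialDeriv j g x) volume := by
      simpa [pow_two] using this.integrable
    exact hi.const_mul 3
  rw [integral_congr_ae (ae_of_all _ hpt), integral_add hi1 hi2, integral_const_mul] at h0
  linarith

/-- **`L⁴` interpolation for first derivatives on the torus** (Gagliardo–Nirenberg, the
elementary case): if `h` is smooth on `𝕋^d` with `|h| ≤ A`, then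
`∫ (∂ⱼh)⁴ ≤ 9 A² ∫ (∂ⱼ∂ⱼh)²`. (From `integral_partialDeriv_pow_four_eq` and Cauchy–Schwarz:
`∫ (∂ⱼh)⁴ ≤ 3A (∫ (∂ⱼh)⁴)^{1/2} (∫ (∂ⱼ²h)²)^{1/2}`.) [cite: Majda1984, Ch. 2 §2.1 Prop. 2.1] -/
theorem integral_partialDeriv_pow_four_le {h : UnitAddTorus d → ℝ} (hh : IsSmooth h) (j : d)
    {A : ℝ} (hA : ∀ x, |h x| ≤ A) :
    ∫ x, partialDeriv j h x ^ 4 ≤ 9 * A ^ 2 * ∫ x, partialDeriv j (partialDeriv j h) x ^ 2 := by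
  classical
  set g := partialDeriv j h with hgdef
  set g₂ := partialDeriv j (partialDeriv j h) with hg₂def
  have hg : IsSmooth g := hh.partialDeriv j
  have hg₂ : IsSmooth g₂ := hg.partialDeriv j
  have hA0 : 0 ≤ A := (abs_nonneg _).trans (hA 0)
  set X := ∫ x, g x ^ 4 with hX
  set Y := ∫ x, g₂ x ^ 2 with hY
  have hX0 : 0 ≤ X := integral_nonneg fun x => by positivity
  have hY0 : 0 ≤ Y := integral_nonneg fun x => by positivity
  -- Cauchy–Schwarz: `∫ g² |g₂| ≤ √X √Y`
  have hcs : ∫ x, g x ^ 2 * |g₂ x| ≤ Real.sqrt X * Real.sqrt Y := by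
    have hf : MemLp (fun x => g x ^ 2) (ENNReal.ofReal 2) volume := by
      have : IsSmooth (fun y => g y * g y) := (ContDiff.mul hg hg : IsSmooth fun y => g y * g y)
      simpa [pow_two] using this.memLp (ENNReal.ofReal 2)
    have hg' : MemLp (fun x => |g₂ x|) (ENNReal.ofReal 2) volume := (hg₂.memLp (ENNReal.ofReal 2)).abs
    have hcs' := integral_mul_le_Lp_mul_Lq_of_nonneg (μ := volume) Real.HolderConjugate.two_two
      (ae_of_all _ fun x => sq_nonneg (g x)) (ae_of_all _ fun x => abs_nonneg (g₂ x)) hf hg'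
    have e1 : ∫ x, (g x ^ 2) ^ (2 : ℝ) = X := by
      rw [hX]
      exact integral_congr_ae (ae_of_all _ fun x => by
        simp only [Real.rpow_two]; ring)
    have e2 : ∫ x, |g₂ x| ^ (2 : ℝ) = Y := by
      rw [hY]
      exact integral_congr_ae (ae_of_all _ fun x => by simp only [Real.rpow_two, sq_abs])
    rw [e1, e2] at hcs'
    rw [Real.sqrt_eq_rpow, Real.sqrt_eq_rpow]
    simpa using hcs'
  -- `X = -3 ∫ h g² g₂ ≤ 3A ∫ g² |g₂|`
  have hib := integral_partialDeriv_pow_four_eq hh j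
  have hint : Integrable (fun x => g x ^ 2 * |g₂ x|) volume := by
    have : IsSmooth (fun y => g y * g y) := (ContDiff.mul hg hg : IsSmooth fun y => g y * g y)
    have h1 : Integrable (fun x => g x ^ 2) volume := by simpa [pow_two] using this.integrable
    refine (h1.mul_of_top_left (hg₂.memLp ⊤).abs)
  have hle : X ≤ 3 * A * (Real.sqrt X * Real.sqrt Y) := by
    have h1 : -3 * ∫ x, h x * g x ^ 2 * g₂ x ≤ 3 * A * ∫ x, g x ^ 2 * |g₂ x| := by
      have hpt : ∀ x, -(h x * g x ^ 2 * g₂ x) ≤ A * (g x ^ 2 * |g₂ x|) := fun x => by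
        have h2 : |h x * g x ^ 2 * g₂ x| ≤ A * (g x ^ 2 * |g₂ x|) := by
          rw [abs_mul, abs_mul, abs_of_nonneg (sq_nonneg (g x)), mul_assoc]
          exact mul_le_mul_of_nonneg_right (hA x) (by positivity)
        exact (neg_le_abs _).trans h2
      have hi3 : Integrable (fun x => h x * g x ^ 2 * g₂ x) volume := by
        have : IsSmooth (fun y => h y * (g y * g y) * g₂ y) :=
          (ContDiff.mul (ContDiff.mul hh (ContDiff.mul hg hg)) hg₂ : IsSmooth fun y => h y * (g y * g y) * g₂ y)
        simpa [pow_two] using this.integrable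
      have h3 : ∫ x, -(h x * g x ^ 2 * g₂ x) ≤ ∫ x, A * (g x ^ 2 * |g₂ x|) :=
        integral_mono hi3.neg (hint.const_mul A) hpt
      rw [integral_neg, integral_const_mul] at h3
      linarith
    calc X = -3 * ∫ x, h x * g x ^ 2 * g₂ x := hib
      _ ≤ 3 * A * ∫ x, g x ^ 2 * |g₂ x| := h1
      _ ≤ 3 * A * (Real.sqrt X * Real.sqrt Y) := mul_le_mul_of_nonneg_left hcs (by positivity)
  -- conclude: `√X ≤ 3A √Y`
  have hsX := Real.sq_sqrt hX0
  have hsY := Real.sq_sqrt hY0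
  have hsX0 := Real.sqrt_nonneg X
  have hsY0 := Real.sqrt_nonneg Y
  nlinarith [sq_nonneg (Real.sqrt X - 3 * A * Real.sqrt Y), mul_nonneg hA0 hsY0]

/-- **`L⁴` interpolation for second derivatives**: for smooth `φ` on `𝕋^d` with `|∂ᵢφ| ≤ A`,
`∫ (∂ⱼ∂ᵢφ)⁴ ≤ 9 A² ∫ (∂ⱼ∂ⱼ∂ᵢφ)²` (the case `h = ∂ᵢφ` of `integral_partialDeriv_pow_four_le`).
[cite: Majda1984, Ch. 2 §2.1 Prop. 2.1] -/
theorem integral_partialDeriv_partialDeriv_pow_four_le {φ : UnitAddTorus d → ℝ} (hφ : IsSmooth φ)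
    (i j : d) {A : ℝ} (hA : ∀ x, |partialDeriv i φ x| ≤ A) :
    ∫ x, partialDeriv j (partialDeriv i φ) x ^ 4 ≤
      9 * A ^ 2 * ∫ x, partialDeriv j (partialDeriv j (partialDeriv i φ)) x ^ 2 :=
  integral_partialDeriv_pow_four_le (hφ.partialDeriv i) j hA

omit [DecidableEq d] in
/-- **Cauchy–Schwarz for products in `L²`**: `∫ (FG)² ≤ (∫ F⁴)^{1/2} (∫ G⁴)^{1/2}` for continuous
`F, G` on `𝕋^d`. [folklore] -/
theorem integral_mul_sq_le {F G : UnitAddTorus d → ℝ} (hF : Continuous F) (hG : Continuous G) :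
    ∫ x, (F x * G x) ^ 2 ≤ Real.sqrt (∫ x, F x ^ 4) * Real.sqrt (∫ x, G x ^ 4) := by
  have hf : MemLp (fun x => F x ^ 2) (ENNReal.ofReal 2) volume :=
    ((hF.pow 2).memLp_of_hasCompactSupport (HasCompactSupport.of_compactSpace _))
  have hg : MemLp (fun x => G x ^ 2) (ENNReal.ofReal 2) volume :=
    ((hG.pow 2).memLp_of_hasCompactSupport (HasCompactSupport.of_compactSpace _))
  have h := integral_mul_le_Lp_mul_Lq_of_nonneg (μ := volume) Real.HolderConjugate.two_two
    (ae_of_all _ fun x => sq_nonneg (F x)) (ae_of_all _ fun x => sq_nonneg (G x)) hf hg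
  have e1 : ∫ x, (F x ^ 2) ^ (2 : ℝ) = ∫ x, F x ^ 4 :=
    integral_congr_ae (ae_of_all _ fun x => by simp only [Real.rpow_two]; ring)
  have e2 : ∫ x, (G x ^ 2) ^ (2 : ℝ) = ∫ x, G x ^ 4 :=
    integral_congr_ae (ae_of_all _ fun x => by simp only [Real.rpow_two]; ring)
  have e3 : ∫ x, (F x * G x) ^ 2 = ∫ x, F x ^ 2 * G x ^ 2 :=
    integral_congr_ae (ae_of_all _ fun x => by ring)
  rw [e1, e2] at h
  rw [e3, Real.sqrt_eq_rpow, Real.sqrt_eq_rpow]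
  simpa using h

/-- **Products of two second derivatives in `L²`** (the critical term of the third-order
commutators): for smooth `φ, ψ` on `𝕋^d` with `|∂ᵢφ| ≤ A`, `|∂ₖψ| ≤ B`,
`∫ (∂ⱼ∂ᵢφ · ∂ₗ∂ₖψ)² ≤ 9 A B (∫ (∂ⱼ²∂ᵢφ)²)^{1/2} (∫ (∂ₗ²∂ₖψ)²)^{1/2}`.
[cite: Majda1984, Ch. 2 §2.1 Prop. 2.1] -/
theorem integral_mul_partialDeriv_partialDeriv_sq_le {φ ψ : UnitAddTorus d → ℝ} (hφ : IsSmooth φ)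
    (hψ : IsSmooth ψ) (i j k l : d) {A B : ℝ} (hA : ∀ x, |partialDeriv i φ x| ≤ A)
    (hB : ∀ x, |partialDeriv k ψ x| ≤ B) :
    ∫ x, (partialDeriv j (partialDeriv i φ) x * partialDeriv l (partialDeriv k ψ) x) ^ 2 ≤
      9 * A * B * (Real.sqrt (∫ x, partialDeriv j (partialDeriv j (partialDeriv i φ)) x ^ 2) *
        Real.sqrt (∫ x, partialDeriv l (partialDeriv l (partialDeriv k ψ)) x ^ 2)) := by
  have hA0 : 0 ≤ A := (abs_nonneg _).trans (hA 0)
  have hB0 : 0 ≤ B := (abs_nonneg _).trans (hB 0)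
  have h1 := integral_mul_sq_le ((hφ.partialDeriv i).partialDeriv j).continuous
    ((hψ.partialDeriv k).partialDeriv l).continuous
  have h2 := integral_partialDeriv_partialDeriv_pow_four_le hφ i j hA
  have h3 := integral_partialDeriv_partialDeriv_pow_four_le hψ k l hB
  set P := ∫ x, partialDeriv j (partialDeriv j (partialDeriv i φ)) x ^ 2
  set Q := ∫ x, partialDeriv l (partialDeriv l (partialDeriv k ψ)) x ^ 2
  have hP : 0 ≤ P := integral_nonneg fun x => by positivity
  have hQ : 0 ≤ Q := integral_nonneg fun x => by positivity
  have h2' : Real.sqrt (∫ x, partialDeriv j (partialDeriv i φ) x ^ 4) ≤ 3 * A * Real.sqrt P := by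
    calc Real.sqrt (∫ x, partialDeriv j (partialDeriv i φ) x ^ 4) ≤ Real.sqrt (9 * A ^ 2 * P) :=
          Real.sqrt_le_sqrt h2
      _ = 3 * A * Real.sqrt P := by
          rw [Real.sqrt_mul (by positivity), show (9 : ℝ) * A ^ 2 = (3 * A) ^ 2 by ring,
            Real.sqrt_sq (by positivity)]
  have h3' : Real.sqrt (∫ x, partialDeriv l (partialDeriv k ψ) x ^ 4) ≤ 3 * B * Real.sqrt Q := by
    calc Real.sqrt (∫ x, partialDeriv l (partialDeriv k ψ) x ^ 4) ≤ Real.sqrt (9 * B ^ 2 * Q) :=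
          Real.sqrt_le_sqrt h3
      _ = 3 * B * Real.sqrt Q := by
          rw [Real.sqrt_mul (by positivity), show (9 : ℝ) * B ^ 2 = (3 * B) ^ 2 by ring,
            Real.sqrt_sq (by positivity)]
  calc _ ≤ _ := h1
    _ ≤ (3 * A * Real.sqrt P) * (3 * B * Real.sqrt Q) :=
        mul_le_mul h2' h3' (Real.sqrt_nonneg _) (by positivity)
    _ = 9 * A * B * (Real.sqrt P * Real.sqrt Q) := by ring

end Torus

end Literature.Analysis.FunctionSpaces

end
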